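import Summits.ValiantsHypothesis.ValiantsHypothesis.Theorems.SymPencilHomogeneousDropRankTwo

/-!
# Route `SymPencil` — the homogeneity drop in codimension `c`: `rank A₀ ≤ 2c` in the kernel-fixed case
# (structural lemma toward the crux `SdcSuperquadratic`, stmt-ValiantsHypothesis-5674)

Codimension-`c` form of `SymPencilHomogeneousDropRankTwo.rank_le_two_of_det_add_smul` (which is
the case `c = 1`).  Setting: `Y = A(x) ≅ 0 ⊕ Δ` in a basis through the kernel vector `w`, a
symmetric `A₀ ≅ 0 ⊕ E` killing `w` (the kernel of `A(λ x)` is fixed along the cone line), and a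
linear family `M` of symmetric matrices with the homogeneity identity
`det (0 ⊕ Δ + M v + ν (0 ⊕ E)) = (1 + ν) ^ j · det (0 ⊕ Δ + M v)`.  If the first-column map of `M`
hits some corner-`1` column and, among the corner-`0` columns `(0, b)`, at least a SUBSPACE `S` of
the `b`'s, then `rank E + 2 dim S ≤ 2 |ι'|`, i.e. `rank E ≤ 2 codim S`
(`rank_add_two_mul_finrank_le_of_det_add_smul`): exactly as in the rank-two file, a generic `ν₀`
and the directions `(1, b₁ + λ b)`, `λ ∈ {0, ±1}`, give `bᵀ ((Δ + ν₀ E)⁻¹ - Δ⁻¹) b = 0` on `S`, and a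
symmetric form vanishing on a subspace of codimension `c` has rank `≤ 2c`
(`rank_add_two_mul_finrank_le_of_quadratic_form_eq_zero`: polarise; `N(S) ⊥ S`, so `N(S)` injects
into the dual of a complement of `S`).

Use (`SymPencilKernelFixedRankCodim`, `SymPencilConeKernelCodim`): for the permanent, a symmetric
affine determinantal representation of size `m` whose kernel-row map at a nondegenerate zero has
a nontrivial kernel ("Case I") has `m - 1 = rank A(0) ≤ 2 (m - n² + 1)`, i.e. `m ≥ 2n² - 3`; so
below `2n² - 3` the kernel-row map is injective at every nondegenerate zero.  Elementary linear
algebra throughout. [folklore]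
-/

noncomputable section

-- single-conjunct layout: Sub = Summit, duplicated namespace component intended
set_option linter.dupNamespace false

namespace Summit.ValiantsHypothesis.ValiantsHypothesis.Theorems.SymPencilHomogeneousDropRankCodim

open Matrix Polynomial
open Summit.ValiantsHypothesis.ValiantsHypothesis.Theorems.SymPencilHomogeneousDropTools
open Summit.ValiantsHypothesis.ValiantsHypothesis.Theorems.SymPencilHomogeneousDropRankTwo

universe u

variable {k : Type u} [Field k]

/-! ### A symmetric form vanishing on a subspace of codimension `c` has rank at most `2c` -/

section RankCodim

variable {ι : Type*} [Fintype ι] [DecidableEq ι]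

/-- **A symmetric matrix whose quadratic form vanishes on a subspace `S` has
`rank + 2 dim S ≤ 2 |ι|`**, i.e. rank `≤ 2 codim S` (`2 ≠ 0`): polarising, `N(S) ⊥ S`, so for a
complement `T` of `S` the pairing with a basis of `T` is injective on `N(S)`, whence
`dim N(S) ≤ dim T`; and `dim N(T) ≤ dim T`. [folklore] -/
theorem rank_add_two_mul_finrank_le_of_quadratic_form_eq_zero [NeZero (2 : k)] {N : Matrix ι ι k}
    (hN : Nᵀ = N) (S : Submodule k (ι → k)) (h : ∀ b ∈ S, b ⬝ᵥ N *ᵥ b = 0) :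
    N.rank + 2 * Module.finrank k S ≤ 2 * Fintype.card ι := by
  -- polarisation on `S`
  have hsym : ∀ b c : ι → k, b ⬝ᵥ N *ᵥ c = c ⬝ᵥ N *ᵥ b := fun b c => by
    rw [Matrix.dotProduct_mulVec, ← Matrix.mulVec_transpose, hN, dotProduct_comm]
  have hpol : ∀ b ∈ S, ∀ c ∈ S, b ⬝ᵥ N *ᵥ c = 0 := by
    intro b hb c hc
    have hbc := h (b + c) (S.add_mem hb hc)
    rw [Matrix.mulVec_add, dotProduct_add, add_dotProduct, add_dotProduct, h b hb, h c hc,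
      hsym c b, zero_add, add_zero, ← two_mul] at hbc
    exact (mul_eq_zero.1 hbc).resolve_left (NeZero.ne 2)
  -- a complement `T` of `S`
  obtain ⟨T, hST⟩ := Submodule.exists_isCompl S
  have hdim : Module.finrank k S + Module.finrank k T = Fintype.card ι := by
    have h1 := Submodule.finrank_sup_add_finrank_inf_eq S T
    rw [hST.sup_eq_top, hST.inf_eq_bot, finrank_top, finrank_bot, add_zero,
      Module.finrank_fintype_fun_eq_card] at h1
    exact h1.symm
  set f := N.mulVecLin with hf
  have hfapp : ∀ b, f b = N *ᵥ b := fun b => rfl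
  have hrange : LinearMap.range f = Submodule.map f S ⊔ Submodule.map f T := by
    rw [LinearMap.range_eq_map, ← Submodule.map_sup, hST.sup_eq_top]
  -- `dim N(T) ≤ dim T`
  have hT : Module.finrank k (Submodule.map f T) ≤ Module.finrank k T :=
    Submodule.finrank_map_le f T
  -- `dim N(S) ≤ dim T`: pair against a basis of `T`
  have hS : Module.finrank k (Submodule.map f S) ≤ Module.finrank k T := by
    let bT := Module.finBasis k T
    let Ψ : (ι → k) →ₗ[k] (Fin (Module.finrank k T) → k) :=
      { toFun := fun u i => u ⬝ᵥ (bT i : ι → k)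
        map_add' := fun u v => by
          ext i
          simp only [add_dotProduct, Pi.add_apply]
        map_smul' := fun c u => by
          ext i
          simp only [smul_dotProduct, Pi.smul_apply, RingHom.id_apply] }
    have hΨ : ∀ u i, Ψ u i = u ⬝ᵥ (bT i : ι → k) := fun u i => rfl
    have hinj : Function.Injective (Ψ.domRestrict (Submodule.map f S)) := by
      rw [← LinearMap.ker_eq_bot, LinearMap.ker_eq_bot']
      rintro ⟨u, hu⟩ hu0
      obtain ⟨b, hb, rfl⟩ := Submodule.mem_map.1 hu
      -- `N b ⬝ t = 0` on the basis of `T`, hence on `T`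
      have hbas : ∀ i, f b ⬝ᵥ (bT i : ι → k) = 0 := fun i => by
        have := congr_fun hu0 i
        rwa [LinearMap.domRestrict_apply, hΨ] at this
      have hT0 : ∀ t ∈ T, f b ⬝ᵥ t = 0 := by
        intro t ht
        let φ : T →ₗ[k] k :=
          { toFun := fun t => f b ⬝ᵥ (t : ι → k)
            map_add' := fun t₁ t₂ => by
              simp only [Submodule.coe_add, dotProduct_add]
            map_smul' := fun c t => by
              simp only [Submodule.coe_smul, dotProduct_smul, smul_eq_mul, RingHom.id_apply] }
        have hφ : φ = 0 := bT.ext fun i => by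
          rw [LinearMap.zero_apply]
          exact hbas i
        have := LinearMap.congr_fun hφ ⟨t, ht⟩
        rwa [LinearMap.zero_apply] at this
      -- `N b ⬝ s = 0` on `S` by polarisation
      have hS0 : ∀ s ∈ S, f b ⬝ᵥ s = 0 := fun s hs => by
        rw [hfapp, dotProduct_comm]
        exact hpol s hs b hb
      have hall : ∀ v : ι → k, f b ⬝ᵥ v = 0 := by
        intro v
        have hv : v ∈ S ⊔ T := by
          rw [hST.sup_eq_top]
          exact Submodule.mem_top
        obtain ⟨s, hs, t, ht, rfl⟩ := Submodule.mem_sup.1 hv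
        rw [dotProduct_add, hS0 s hs, hT0 t ht, add_zero]
      have hfb : f b = 0 := by
        ext i
        have := hall (Pi.single i 1)
        rwa [dotProduct_single_one] at this
      exact Subtype.ext hfb
    have := LinearMap.finrank_le_finrank_of_injective hinj
    rwa [Module.finrank_fintype_fun_eq_card, Fintype.card_fin] at this
  have hrk : N.rank ≤ Module.finrank k (Submodule.map f S) + Module.finrank k (Submodule.map f T) :=
    calc N.rank = Module.finrank k (LinearMap.range f) := rfl
      _ = Module.finrank k ↥(Submodule.map f S ⊔ Submodule.map f T) := by rw [hrange]
      _ ≤ _ := Submodule.finrank_add_le_finrank_add_finrank _ _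
  omega

end RankCodim

/-! ### The core lemma, kernel-fixed case, codimension `c` -/

section Core

variable [CharZero k] {ι' : Type*} [Fintype ι'] [DecidableEq ι']
  {V : Type*} [AddCommGroup V] [Module k V]

/-- **Homogeneity drop, kernel-fixed case, codimension `c`.** Let `Δ` be invertible symmetric, `E`
symmetric, `M` a linear family of symmetric matrices on `Unit ⊕ ι'` with
`det (0 ⊕ Δ + M v + ν (0 ⊕ E)) = (1 + ν) ^ j · det (0 ⊕ Δ + M v)` for all `v` and `ν ≠ -1`.  If
some `M v` has corner `1`, and every column `(0, b)` with `b` in the subspace `S` is the first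
column of some `M v`, then `rank E + 2 dim S ≤ 2 |ι'|` (`rank E ≤ 2 codim S`; the case
`codim S = 1` is `SymPencilHomogeneousDropRankTwo.rank_le_two_of_det_add_smul`). [folklore] -/
theorem rank_add_two_mul_finrank_le_of_det_add_smul (Δ E : Matrix ι' ι' k) (hΔ : IsUnit Δ.det)
    (hΔs : Δᵀ = Δ) (hEs : Eᵀ = E) (j : ℕ) (M : V →ₗ[k] Matrix (Unit ⊕ ι') (Unit ⊕ ι') k)
    (hMs : ∀ v, (M v)ᵀ = M v)
    (hH : ∀ (v : V) (ν : k), ν ≠ -1 →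
      (Matrix.fromBlocks (0 : Matrix Unit Unit k) 0 0 Δ + M v +
          ν • Matrix.fromBlocks (0 : Matrix Unit Unit k) 0 0 E).det =
        (1 + ν) ^ j * (Matrix.fromBlocks (0 : Matrix Unit Unit k) 0 0 Δ + M v).det)
    (h1 : ∃ v, M v (Sum.inl ()) (Sum.inl ()) = 1) (S : Submodule k (ι' → k))
    (h0 : ∀ b ∈ S, ∃ v, M v (Sum.inl ()) (Sum.inl ()) = 0 ∧ ∀ i, M v (Sum.inr i) (Sum.inl ()) = b i) :
    E.rank + 2 * Module.finrank k S ≤ 2 * Fintype.card ι' := by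
  classical
  have hΔ0 : Δ.det ≠ 0 := hΔ.ne_zero
  -- `0 ⊕ E` in the block form of the tools file
  have hA₀ : Matrix.fromBlocks (0 : Matrix Unit Unit k) 0 0 E =
      Matrix.fromBlocks ((0 : k) • (1 : Matrix Unit Unit k)) (Matrix.replicateRow Unit (0 : ι' → k))
        (Matrix.replicateCol Unit (0 : ι' → k)) E := by
    ext (i | i) (j | j) <;> simp
  -- the identity along a direction with first column `(a, b)`, scaled by `ε`, at `ν`
  have hHdir : ∀ (v : V) (a : k) (b : ι' → k), M v (Sum.inl ()) (Sum.inl ()) = a →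
      (∀ i, M v (Sum.inr i) (Sum.inl ()) = b i) → ∀ (ε ν : k), ν ≠ -1 →
      (Matrix.fromBlocks ((ε * a) • (1 : Matrix Unit Unit k))
        (Matrix.replicateRow Unit (ε • b)) (Matrix.replicateCol Unit (ε • b))
        (Δ + ε • (M v).toBlocks₂₂ + ν • E)).det =
      (1 + ν) ^ j * (Matrix.fromBlocks ((ε * a) • (1 : Matrix Unit Unit k))
        (Matrix.replicateRow Unit (ε • b)) (Matrix.replicateCol Unit (ε • b))
        (Δ + ε • (M v).toBlocks₂₂)).det := by
    intro v a b ha hb ε ν hν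
    have h := hH (ε • v) ν hν
    rw [map_smul, eq_fromBlocks_of_col (hMs v) ha hb, hA₀, fromBlocks_add_smul_add_smul,
      fromBlocks_add_smul, mul_zero, add_zero, smul_zero, add_zero] at h
    exact h
  -- a generic `ν₀`
  have hq0 : (Δ.map Polynomial.C + (Polynomial.X : k[X]) • E.map Polynomial.C).det ≠ 0 := by
    intro h
    have h0 := coeff_detLine_zero Δ E
    rw [h, Polynomial.coeff_zero] at h0
    exact hΔ0 h0.symm
  obtain ⟨ν₀, hν₀⟩ := Infinite.exists_notMem_finset
    ((Δ.map Polynomial.C + (Polynomial.X : k[X]) • E.map Polynomial.C).det.roots.toFinset ∪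
      {0, -1})
  simp only [Finset.mem_union, Multiset.mem_toFinset, Polynomial.mem_roots hq0,
    Polynomial.IsRoot.def, eval_detLine, Finset.mem_insert, Finset.mem_singleton, not_or] at hν₀
  obtain ⟨hΔ'0, hν00, hν01⟩ := hν₀
  set Δ' : Matrix ι' ι' k := Δ + ν₀ • E with hΔ'
  have hΔ'u : IsUnit Δ'.det := isUnit_iff_ne_zero.2 hΔ'0
  -- `tr (((Δ')⁻¹ - Δ⁻¹) (C - b bᵀ)) = 0` along every direction with corner `1`
  have hS2 : ∀ (v : V) (b : ι' → k), M v (Sum.inl ()) (Sum.inl ()) = 1 →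
      (∀ i, M v (Sum.inr i) (Sum.inl ()) = b i) →
      ((Δ'⁻¹ - Δ⁻¹) * ((M v).toBlocks₂₂ - Matrix.vecMulVec b b)).trace = 0 := by
    intro v b hva hvb
    set C : Matrix ι' ι' k := (M v).toBlocks₂₂ with hC
    set N₂ : Matrix ι' ι' k := C - Matrix.vecMulVec b b with hN₂
    have key : ∀ ε : k, ε ∉ ({0} : Finset k) →
        (Δ' + ε • N₂).det = (1 + ν₀) ^ j * (1 + 0 * ε) ^ j * (Δ + ε • N₂).det := by
      intro ε hε
      simp only [Finset.mem_singleton] at hε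
      have h := hHdir v 1 b hva hvb ε ν₀ hν01
      rw [mul_one, det_fromBlocks_corner hε, det_fromBlocks_corner hε,
        inv_smul_vecMulVec_smul hε] at h
      have hm1 : Δ + ε • C + ν₀ • E - ε • Matrix.vecMulVec b b = Δ' + ε • N₂ := by
        rw [hΔ', hN₂, smul_sub]; abel
      have hm2 : Δ + ε • C - ε • Matrix.vecMulVec b b = Δ + ε • N₂ := by
        rw [hN₂, smul_sub]; abel
      rw [hm1, hm2, ← mul_assoc, mul_comm ((1 + ν₀) ^ j) ε, mul_assoc] at h
      rw [zero_mul, add_zero, one_pow, mul_one]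
      exact mul_left_cancel₀ hε h
    obtain ⟨h0', h1'⟩ := coeff_eq_of_det_add_smul_eq _ key
    rw [coeff_detLine_one hΔ'u, coeff_detLine_one hΔ, mul_zero, zero_mul, zero_add,
      ← mul_assoc, ← h0'] at h1'
    have h2 : (Δ'⁻¹ * N₂).trace = (Δ⁻¹ * N₂).trace := mul_left_cancel₀ hΔ'0 h1'
    rw [Matrix.sub_mul, Matrix.trace_sub, h2, sub_self]
  -- the quadratic form of `N := (Δ')⁻¹ - Δ⁻¹` vanishes on `S`
  have hquad : ∀ b ∈ S, b ⬝ᵥ (Δ'⁻¹ - Δ⁻¹) *ᵥ b = 0 := by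
    intro b hb
    obtain ⟨v₁, h1a⟩ := h1
    set b₁ : ι' → k := fun i => M v₁ (Sum.inr i) (Sum.inl ()) with hb₁
    obtain ⟨u, hua, hub⟩ := h0 b hb
    have g : ∀ c : k, ((Δ'⁻¹ - Δ⁻¹) * ((M v₁).toBlocks₂₂ + c • (M u).toBlocks₂₂ -
        (Matrix.vecMulVec b₁ b₁ + c • (Matrix.vecMulVec b₁ b + Matrix.vecMulVec b b₁) +
          c ^ 2 • Matrix.vecMulVec b b))).trace = 0 := by
      intro c
      have h := hS2 (v₁ + c • u) (b₁ + c • b) (by simp [h1a, hua])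
        (fun i => by simp [hb₁, hub])
      have hT : (M (v₁ + c • u)).toBlocks₂₂ = (M v₁).toBlocks₂₂ + c • (M u).toBlocks₂₂ := by
        ext i j
        simp [Matrix.toBlocks₂₂]
      have hV : Matrix.vecMulVec (b₁ + c • b) (b₁ + c • b) =
          Matrix.vecMulVec b₁ b₁ + c • (Matrix.vecMulVec b₁ b + Matrix.vecMulVec b b₁) +
            c ^ 2 • Matrix.vecMulVec b b := by
        rw [Matrix.add_vecMulVec, Matrix.vecMulVec_add, Matrix.vecMulVec_add,
          Matrix.smul_vecMulVec, Matrix.vecMulVec_smul, Matrix.smul_vecMulVec,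
          Matrix.vecMulVec_smul, smul_smul, ← pow_two, smul_add]
        abel
      rwa [hT, hV] at h
    have g0 := g 0
    have g1 := g 1
    have g2 := g (-1)
    simp only [Matrix.mul_add, Matrix.mul_sub, Matrix.mul_smul, Matrix.trace_add,
      Matrix.trace_sub, Matrix.trace_smul, trace_mul_vecMulVec, smul_eq_mul] at g0 g1 g2
    have h3 : (2 : k) * ((Δ'⁻¹ - Δ⁻¹) *ᵥ b ⬝ᵥ b) = 0 := by
      linear_combination 2 * g0 - g1 - g2
    rw [dotProduct_comm]
    exact (mul_eq_zero.1 h3).resolve_left two_ne_zero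
  -- so `rank N + 2 dim S ≤ 2 |ι'|`, and `ν₀ E = -Δ N Δ'`
  have hNs : (Δ'⁻¹ - Δ⁻¹)ᵀ = Δ'⁻¹ - Δ⁻¹ := by
    have hΔ's : Δ'ᵀ = Δ' := by rw [hΔ', Matrix.transpose_add, Matrix.transpose_smul, hΔs, hEs]
    rw [Matrix.transpose_sub, Matrix.transpose_nonsing_inv, Matrix.transpose_nonsing_inv, hΔ's,
      hΔs]
  have hNr := rank_add_two_mul_finrank_le_of_quadratic_form_eq_zero hNs S hquad
  have hE : E = ((-ν₀⁻¹) • Δ) * (Δ'⁻¹ - Δ⁻¹) * Δ' := by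
    have h1 : Δ * (Δ'⁻¹ - Δ⁻¹) * Δ' = Δ - Δ' := by
      rw [Matrix.mul_sub, Matrix.sub_mul, Matrix.mul_nonsing_inv _ hΔ, Matrix.one_mul,
        Matrix.mul_assoc, Matrix.nonsing_inv_mul _ hΔ'u, Matrix.mul_one]
    rw [Matrix.smul_mul, Matrix.smul_mul, h1, hΔ', sub_add_cancel_left, smul_neg, smul_smul,
      neg_mul, inv_mul_cancel₀ hν00, neg_smul, one_smul, neg_neg]
  have hEr : E.rank ≤ (Δ'⁻¹ - Δ⁻¹).rank := by
    rw [hE]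
    exact (Matrix.rank_mul_le_left _ _).trans (Matrix.rank_mul_le_right _ _)
  omega

end Core

end Summit.ValiantsHypothesis.ValiantsHypothesis.Theorems.SymPencilHomogeneousDropRankCodim

end
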